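import Mathlib
import Summits.Schanuel.Schanuel.Theorems.SoloInformedRankTwoCensus

/-!
# The automorphism door: what an endomorphism of `ℂ_exp` can and cannot do for Schanuel pairs

Soloist seat `solo-Schanuel-informed`, session 9 (atlas §2 E11 / door (F), sharpened).

Let `End(ℂ_exp)` be the monoid of ring endomorphisms `σ` of `ℂ` with `σ(e^z) = e^{σ z}` (they
are injective; surjectivity is never used below) and `G = Aut(ℂ_exp)` its group of units.
Complex conjugation `c ∈ G`; whether `G = {1, c}` is open — it is one face of the two main open
questions on `ℂ_exp`, Zilber's conjecture `ℂ_exp ≅ 𝔹` and the definability of `ℝ` in `ℂ_exp`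
[KMO2012, Introduction; AK2025, §6.4]. Symmetry under an element of `G` is the lever of
L. Denis's proof of the Carlitz-module analogue of `e ⟂ π` [Denis1995] and of the "conjugation
rung" (tree: `SoloBlindConjugationRung`, `algebraicIndependent_cons_exp_of_conj`: Schanuel's
conjecture at `(iπ, α₁, …, αₙ)` for algebraic `α` off the eigenlines `ℝ ∪ iℝ` of `c`). This file
types how far ANY element of `End(ℂ_exp)`, known or not, can carry that lever towards the six
emblematic open pairs `(1, iπ), (1, e), (iπ, log 2), (1, log 2), (log 2, log 3), (log 2, √2 log 2)`
of rank two [Waldschmidt2000, §1.4]: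

1. **Shut at `(1, iπ)` and `(1, e)`** (unconditional): every `σ ∈ End(ℂ_exp)` fixes `e = exp 1`
   and `e^e`, and maps `2πi ↦ ±2πi`, `π ↦ ±π` (`expEnd_apply_exp_one`, `expEnd_apply_exp_exp_one`,
   `expEnd_apply_two_pi_I`, `expEnd_apply_pi`; the sign is all that complex conjugation already
   does). So no symmetry argument inside `ℂ_exp` separates `e` from `π`, or `e` from `e^e`.
2. **Open exactly as wide as `End(ℂ_exp)` moves `log 2`** (proved as an implication): if some
   `σ ∈ End(ℂ_exp)` moves `log 2` — necessarily to `log 2 + 2πi·n`, `n ≠ 0` — then `log 2, π` are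
   algebraically independent and `log 2, e` are algebraically independent
   (`algebraicIndependent_log_pi_of_expEnd`, `algebraicIndependent_log_exp_one_of_expEnd`, for any
   real `ℓ` with `e^ℓ ∈ ℚ` in place of `log 2`), i.e. Schanuel's conjecture holds at `(iπ, log 2)`
   and at `(1, log 2)` in the summit's format (`two_le_trdeg_expField_piI_log_of_expEnd`,
   `two_le_trdeg_expField_one_log_of_expEnd`, `schanuel_pairs_log_two_of_expEnd_moves`). The
   mechanism is a SHEAR: replacing `σ` by `σ²` or `(cσ)²` gives `φ ∈ End(ℂ_exp)` with `φ(π) = π`,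
   `φ(e) = e`, `φ(log 2) = log 2 + a`, `a ∈ 2πiℤ ∖ {0}`; a polynomial relation `P(log 2, π) = 0`
   over `ℚ` is transported to `P(log 2 + ka, π) = 0` for every `k ∈ ℕ`, hence `P(w, π) = 0` for
   all `w ∈ ℂ`, and one algebraically independent partner of `π` (Nesterenko's `e^π`) or of `e`
   (Lindemann–Weierstrass's `e^{i}`) kills `P` (`algebraicIndependent_of_shear`, pure algebra).

Reading. In Zilber's field `𝔹` the model-theoretic algebraic closure of `∅` is `⟨2πiℚ⟩^{EA}`
[AK2025, Thm 1.1, §6.4], automorphisms act on logarithms by translations along `2πiℤ`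
[AK2025, §4 Case 1], and the pointwise-definable algebraic numbers are exactly the real abelian
ones [KMO2012, Thms 1–2]; under Zilber's conjecture `ℂ_exp ≅ 𝔹` the hypothesis of item 2 holds —
but that conjecture contains Schanuel's. Unconditionally, item 2 says that exhibiting ONE element
of `End(ℂ_exp)` moving `log 2` is at least as hard as two of the six emblematic pairs, and item 1
says that at `(1, iπ)` and `(1, e)` the door is shut for the whole monoid. Nothing here is deep;
the point is the exact placement. No new definitions.

References: [Denis1995] L. Denis, Acta Arith. 69 (1995) 75–89, doi:10.4064/aa-69-1-75-89;
[KMO2012] J. Kirby, A. Macintyre, A. Onshuus, The algebraic numbers definable in various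
exponential fields, J. Inst. Math. Jussieu 11 (2012) 825–834, doi:10.1017/s1474748012000047,
arXiv:1101.4224 (Thms 1, 2; Introduction); [AK2025] V. Aslanyan, J. Kirby, The model-theoretic
algebraic closure of Zilber's exponential field, Model Theory 4 (2025) 37–54,
doi:10.2140/mt.2025.4.37, arXiv:2405.01399 (Thm 1.1, §4, §6.4); [Waldschmidt2000]
M. Waldschmidt, Diophantine approximation on linear algebraic groups, Grundlehren 326 (2000),
§1.4; Nesterenko 1996 via the tree's `Literature.Barriers.Schanuel.algebraicIndependent_pi_cexp_pi`;
Lindemann–Weierstrass via the tree's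
`Literature.NumberTheory.Transcendental.algebraicIndependent_exp_holds`.
-/

noncomputable section

open Complex IntermediateField
open scoped ComplexConjugate

namespace Summit.Schanuel.Schanuel.Theorems

/-! ### 1. What every endomorphism of `ℂ_exp` fixes -/

/-- Every endomorphism of `ℂ_exp` fixes `e`. [folklore] -/
theorem expEnd_apply_exp_one (σ : ℂ →+* ℂ) (hσ : ∀ z, σ (cexp z) = cexp (σ z)) :
    σ (cexp 1) = cexp 1 := by
  rw [hσ, map_one]

/-- Every endomorphism of `ℂ_exp` fixes `e^e`. [folklore] -/
theorem expEnd_apply_exp_exp_one (σ : ℂ →+* ℂ) (hσ : ∀ z, σ (cexp z) = cexp (σ z)) :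
    σ (cexp (cexp 1)) = cexp (cexp 1) := by
  rw [hσ, hσ, map_one]

/-- Every ring endomorphism of `ℂ` maps `i ↦ ±i`. [folklore] -/
theorem ringHom_apply_I (φ : ℂ →+* ℂ) : φ I = I ∨ φ I = -I := by
  have h : φ I * φ I = -1 := by rw [← map_mul, I_mul_I, map_neg, map_one]
  have h2 : (φ I - I) * (φ I + I) = 0 := by
    have : (φ I - I) * (φ I + I) = φ I * φ I - I * I := by ring
    rw [this, h, I_mul_I, sub_self]
  rcases mul_eq_zero.mp h2 with h3 | h3
  · exact Or.inl (sub_eq_zero.mp h3)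
  · exact Or.inr (add_eq_zero_iff_eq_neg.mp h3)

/-- `2πi ≠ 0`. [folklore] -/
private theorem two_pi_I_ne_zero' : (2 * Real.pi * I : ℂ) ≠ 0 := by
  simp [Real.pi_ne_zero, I_ne_zero]

/-- Every endomorphism `σ` of `ℂ_exp` (a ring endomorphism of `ℂ` commuting with `exp`;
injective automatically, surjectivity NOT assumed) maps the kernel generator `2πi ↦ ±2πi`.
Proof: `σ(2πi) = m·2πi` with `m ∈ ℤ` since `e^{σ(2πi)} = σ(1) = 1`; `m ≠ 0` by injectivity; then
`σ(2πi/m) = 2πi`, so `σ(ζ_m) = σ(e^{2πi/m}) = e^{2πi} = 1 = σ(1)`, whence `e^{2πi/m} = 1`, i.e.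
`1/m ∈ ℤ`. [folklore] -/
theorem expEnd_apply_two_pi_I (σ : ℂ →+* ℂ) (hσ : ∀ z, σ (cexp z) = cexp (σ z)) :
    σ (2 * Real.pi * I) = 2 * Real.pi * I ∨ σ (2 * Real.pi * I) = -(2 * Real.pi * I) := by
  have hτ := two_pi_I_ne_zero'
  have h1 : cexp (σ (2 * Real.pi * I)) = 1 := by rw [← hσ, Complex.exp_two_pi_mul_I, map_one]
  obtain ⟨m, hm⟩ := Complex.exp_eq_one_iff.mp h1
  have hm0 : (m : ℂ) ≠ 0 := by
    intro h
    rw [h, zero_mul] at hm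
    exact hτ (σ.injective (by rw [hm, map_zero]))
  have h2 : σ (2 * Real.pi * I / m) = 2 * Real.pi * I := by
    rw [map_div₀, map_intCast, hm, mul_div_assoc, mul_div_cancel₀ _ hm0]
  have h3 : cexp (2 * Real.pi * I / m) = 1 := by
    apply σ.injective
    rw [hσ, h2, Complex.exp_two_pi_mul_I, map_one]
  obtain ⟨k, hk⟩ := Complex.exp_eq_one_iff.mp h3
  have h4 : (1 : ℂ) * (2 * Real.pi * I) = ((m : ℂ) * k) * (2 * Real.pi * I) := by
    calc (1 : ℂ) * (2 * Real.pi * I) = 2 * Real.pi * I / m * m := by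
          rw [one_mul, div_mul_cancel₀ _ hm0]
      _ = k * (2 * Real.pi * I) * m := by rw [hk]
      _ = ((m : ℂ) * k) * (2 * Real.pi * I) := by ring
  have h5 : ((m * k : ℤ) : ℂ) = 1 := by
    push_cast
    exact (mul_right_cancel₀ hτ h4).symm
  have h6 : m * k = 1 := by exact_mod_cast h5
  rcases Int.eq_one_or_neg_one_of_mul_eq_one h6 with h | h
  · left
    rw [hm, h]
    simp
  · right
    rw [hm, h]
    simp

/-- Every endomorphism of `ℂ_exp` maps `π ↦ ±π`. [folklore] -/
theorem expEnd_apply_pi (σ : ℂ →+* ℂ) (hσ : ∀ z, σ (cexp z) = cexp (σ z)) :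
    σ (Real.pi : ℂ) = Real.pi ∨ σ (Real.pi : ℂ) = -Real.pi := by
  have hτsq : (σ (2 * Real.pi * I)) ^ 2 = (2 * Real.pi * I) ^ 2 := by
    rcases expEnd_apply_two_pi_I σ hσ with h | h <;> rw [h]; ring
  have hpi : (Real.pi : ℂ) ^ 2 = -((2 * Real.pi * I) ^ 2) / 4 := by
    have hI : I ^ 2 = -1 := I_sq
    field_simp
    ring_nf
    rw [hI]
    ring
  have h : (σ (Real.pi : ℂ)) ^ 2 = (Real.pi : ℂ) ^ 2 := by
    conv_lhs => rw [← map_pow, hpi, map_div₀, map_neg, map_pow, hτsq, map_ofNat, ← hpi]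
  exact sq_eq_sq_iff_eq_or_eq_neg.mp h

/-! ### 2. The shear mechanism (pure algebra) -/

/-- A ring endomorphism of `ℂ` commutes with evaluation of `ℚ`-polynomials. [folklore] -/
theorem ringHom_apply_aeval (φ : ℂ →+* ℂ) {n : ℕ} (v : Fin n → ℂ) (P : MvPolynomial (Fin n) ℚ) :
    φ (MvPolynomial.aeval v P) = MvPolynomial.aeval (fun i => φ (v i)) P := by
  have h := MvPolynomial.comp_aeval (R := ℚ) (f := v) φ.toRatAlgHom
  have h' := AlgHom.congr_fun h P
  simpa [AlgHom.comp_apply, RingHom.toRatAlgHom_apply] using h'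

/-- **Shear transport.** If an endomorphism `φ` of `ℂ` translates `x` by `a ≠ 0` and fixes `a` and
`y`, then every `ℚ`-polynomial relation `P(x, y) = 0` forces `P(w, y) = 0` for ALL `w ∈ ℂ`
(`P(x + ka, y) = 0` for every `k ∈ ℕ`, so the polynomial `t ↦ P(x + at, y)` vanishes).
[this file] -/
theorem aeval_pair_eq_zero_of_shear (φ : ℂ →+* ℂ) {x y a : ℂ} (hx : φ x = x + a)
    (ha : φ a = a) (hy : φ y = y) (ha0 : a ≠ 0) {P : MvPolynomial (Fin 2) ℚ}
    (hP : MvPolynomial.aeval ![x, y] P = 0) (w : ℂ) : MvPolynomial.aeval ![w, y] P = 0 := by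
  -- translates by the iterates of `φ`
  have hk : ∀ k : ℕ, MvPolynomial.aeval ![x + a * k, y] P = 0 := by
    intro k
    induction k with
    | zero => simpa using hP
    | succ k ih =>
      have h1 := congrArg φ ih
      rw [map_zero, ringHom_apply_aeval] at h1
      have hv : (fun i => φ (![x + a * k, y] i)) = ![x + a * (k + 1 : ℕ), y] := by
        funext i
        fin_cases i
        · simp [map_add, map_mul, map_natCast, hx, ha]
          ring
        · simp [hy]
      rw [hv] at h1
      exact h1
  -- the one-variable polynomial `Q(t) = P(x + a t, y)`
  set Q : Polynomial ℂ :=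
    MvPolynomial.aeval ![Polynomial.C x + Polynomial.C a * Polynomial.X, Polynomial.C y] P with hQ
  have hQt : ∀ t : ℂ, Q.eval t = MvPolynomial.aeval ![x + a * t, y] P := by
    intro t
    have h := MvPolynomial.comp_aeval (R := ℚ)
      (f := ![Polynomial.C x + Polynomial.C a * Polynomial.X, Polynomial.C y])
      ((Polynomial.aeval t : Polynomial ℂ →ₐ[ℂ] ℂ).restrictScalars ℚ)
    have h' := AlgHom.congr_fun h P
    simp only [AlgHom.comp_apply, AlgHom.coe_restrictScalars', Polynomial.coe_aeval_eq_eval]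
      at h'
    have hv : (fun i => Polynomial.eval t
        (![Polynomial.C x + Polynomial.C a * Polynomial.X, Polynomial.C y] i)) = ![x + a * t, y] := by
      funext i
      fin_cases i <;> simp
    rw [hQ, h', hv]
  have hQ0 : Q = 0 := by
    apply Polynomial.eq_zero_of_infinite_isRoot
    refine Set.Infinite.mono ?_ (Set.infinite_range_of_injective (Nat.cast_injective (R := ℂ)))
    rintro t ⟨k, rfl⟩
    simp only [Set.mem_setOf_eq, Polynomial.IsRoot.def, hQt]
    exact hk k
  have h := hQt ((w - x) / a)
  rw [hQ0, Polynomial.eval_zero, mul_div_cancel₀ _ ha0, add_sub_cancel] at h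
  exact h.symm

/-- **Shear ⟹ algebraic independence**, given one algebraically independent partner `w₀` of `y`.
[this file] -/
theorem algebraicIndependent_of_shear (φ : ℂ →+* ℂ) {x y a w₀ : ℂ} (hx : φ x = x + a)
    (ha : φ a = a) (hy : φ y = y) (ha0 : a ≠ 0) (hw : AlgebraicIndependent ℚ ![w₀, y]) :
    AlgebraicIndependent ℚ ![x, y] := by
  rw [algebraicIndependent_iff_injective_aeval, injective_iff_map_eq_zero]
  intro P hP
  have h := aeval_pair_eq_zero_of_shear φ hx ha hy ha0 hP w₀
  exact (injective_iff_map_eq_zero _).mp (algebraicIndependent_iff_injective_aeval.mp hw) P h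

/-- **Half-shear.** An endomorphism `ρ` with `ρ x = x + n t`, `ρ t = t`, `ρ y = ±y` (`n ≠ 0`,
`t ≠ 0`) gives, squared, a shear fixing `y`; hence `x, y` are algebraically independent as soon as
`y` has one algebraically independent partner. [this file] -/
theorem algebraicIndependent_of_halfShear (ρ : ℂ →+* ℂ) {x y t w₀ : ℂ} {n : ℤ}
    (hx : ρ x = x + n * t) (ht : ρ t = t) (hy : ρ y = y ∨ ρ y = -y) (hn : n ≠ 0) (ht0 : t ≠ 0)
    (hw : AlgebraicIndependent ℚ ![w₀, y]) : AlgebraicIndependent ℚ ![x, y] := by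
  refine algebraicIndependent_of_shear (ρ.comp ρ) (a := 2 * n * t) ?_ ?_ ?_ ?_ hw
  · simp only [RingHom.comp_apply, hx, map_add, map_mul, map_intCast, ht]
    ring
  · simp only [RingHom.comp_apply, map_mul, map_ofNat, map_intCast, ht]
  · rcases hy with h | h <;> simp [RingHom.comp_apply, h]
  · have : (n : ℂ) ≠ 0 := by exact_mod_cast hn
    exact mul_ne_zero (mul_ne_zero two_ne_zero this) ht0

/-! ### 3. Automorphisms of `ℂ_exp` moving a real logarithm of a rational number -/

/-- An endomorphism of `ℂ_exp` moves a real `ℓ` with `e^ℓ ∈ ℚ` along `ℓ + 2πiℤ`. [folklore;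
cf. AK2025, §4 Case 1 for `𝔹`] -/
theorem expEnd_apply_log (σ : ℂ →+* ℂ) (hσ : ∀ z, σ (cexp z) = cexp (σ z)) {ℓ : ℝ} {q : ℚ}
    (hℓ : Real.exp ℓ = q) : ∃ n : ℤ, σ ℓ = ℓ + n * (2 * Real.pi * I) := by
  have hq : cexp (ℓ : ℂ) = (q : ℂ) := by
    rw [← Complex.ofReal_exp, hℓ, Complex.ofReal_ratCast]
  have h : cexp (σ ℓ) = cexp ℓ := by rw [← hσ, hq, map_ratCast]
  exact Complex.exp_eq_exp_iff_exists_int.mp h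

/-- `conj (2πi) = -2πi`. [folklore] -/
private theorem conj_two_pi_I : conj (2 * (Real.pi : ℂ) * I) = -(2 * Real.pi * I) := by
  simp [map_mul, map_ofNat, Complex.conj_ofReal, Complex.conj_I]

/-- `e^π, π` are algebraically independent (Nesterenko), in this order. -/
private theorem algebraicIndependent_cexp_pi_pi :
    AlgebraicIndependent ℚ ![cexp Real.pi, (Real.pi : ℂ)] := by
  have h := Literature.Barriers.Schanuel.algebraicIndependent_pi_cexp_pi.comp ![(1 : Fin 2), 0]
    (by decide)
  convert h using 1
  funext i
  fin_cases i <;> rfl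

/-- `e^{i}, e` are algebraically independent (Lindemann–Weierstrass). -/
private theorem algebraicIndependent_cexp_I_cexp_one :
    AlgebraicIndependent ℚ ![cexp I, cexp 1] := by
  have hli : LinearIndependent ℚ ![I, (1 : ℂ)] := by
    refine LinearIndependent.pair_iff.mpr fun s t hst => ?_
    have h1 := congrArg Complex.re hst
    have h2 := congrArg Complex.im hst
    simp at h1 h2
    exact ⟨by exact_mod_cast h2, by exact_mod_cast h1⟩
  have halg : ∀ i, IsAlgebraic ℚ (![I, (1 : ℂ)] i) :=
    Fin.forall_fin_two.mpr ⟨Literature.Barriers.Schanuel.isAlgebraic_I, isAlgebraic_one⟩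
  have h := Literature.NumberTheory.Transcendental.algebraicIndependent_exp_holds ![I, (1 : ℂ)]
    halg hli
  convert h using 1
  funext i
  fin_cases i <;> rfl

/-- **Theorem O (ii-a).** If an endomorphism of `ℂ_exp` MOVES a real number `ℓ` with `e^ℓ ∈ ℚ`,
then `ℓ` and `π` are algebraically independent. (For `ℓ = log 2` this is Schanuel's conjecture at
the emblematic pair `(iπ, log 2)`.) Partner: Nesterenko's `e^π`. [this file] -/
theorem algebraicIndependent_log_pi_of_expEnd (σ : ℂ →+* ℂ)
    (hσ : ∀ z, σ (cexp z) = cexp (σ z)) {ℓ : ℝ} {q : ℚ} (hℓ : Real.exp ℓ = q)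
    (hmove : σ ℓ ≠ ℓ) : AlgebraicIndependent ℚ ![(ℓ : ℂ), (Real.pi : ℂ)] := by
  obtain ⟨n, hn⟩ := expEnd_apply_log σ hσ hℓ
  have hn0 : n ≠ 0 := by
    rintro rfl
    simp at hn
    exact hmove hn
  rcases expEnd_apply_two_pi_I σ hσ with hτσ | hτσ
  · exact algebraicIndependent_of_halfShear σ (t := 2 * Real.pi * I) (n := n) hn hτσ
      (expEnd_apply_pi σ hσ) hn0 two_pi_I_ne_zero' algebraicIndependent_cexp_pi_pi
  · refine algebraicIndependent_of_halfShear ((starRingEnd ℂ).comp σ)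
      (t := 2 * Real.pi * I) (n := -n) ?_ ?_ ?_ (neg_ne_zero.mpr hn0) two_pi_I_ne_zero'
      algebraicIndependent_cexp_pi_pi
    · simp only [RingHom.comp_apply, hn, map_add, map_mul,
        map_intCast, map_ofNat, Complex.conj_ofReal, Complex.conj_I]
      push_cast
      ring
    · simp only [RingHom.comp_apply, hτσ, map_neg, conj_two_pi_I,
        neg_neg]
    · rcases expEnd_apply_pi σ hσ with h | h
      · left
        simp only [RingHom.comp_apply, h, Complex.conj_ofReal]
      · right
        simp only [RingHom.comp_apply, h, map_neg, Complex.conj_ofReal]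

/-- **Theorem O (ii-b).** If an endomorphism of `ℂ_exp` MOVES a real number `ℓ` with `e^ℓ ∈ ℚ`,
then `ℓ` and `e` are algebraically independent. (For `ℓ = log 2` this is Schanuel's conjecture at
the emblematic pair `(1, log 2)`.) Partner: `e^{i}` (Lindemann–Weierstrass). [this file] -/
theorem algebraicIndependent_log_exp_one_of_expEnd (σ : ℂ →+* ℂ)
    (hσ : ∀ z, σ (cexp z) = cexp (σ z)) {ℓ : ℝ} {q : ℚ} (hℓ : Real.exp ℓ = q)
    (hmove : σ ℓ ≠ ℓ) : AlgebraicIndependent ℚ ![(ℓ : ℂ), cexp 1] := by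
  obtain ⟨n, hn⟩ := expEnd_apply_log σ hσ hℓ
  have hn0 : n ≠ 0 := by
    rintro rfl
    simp at hn
    exact hmove hn
  rcases expEnd_apply_two_pi_I σ hσ with hτσ | hτσ
  · exact algebraicIndependent_of_halfShear σ (t := 2 * Real.pi * I) (n := n) hn hτσ
      (Or.inl (expEnd_apply_exp_one σ hσ)) hn0 two_pi_I_ne_zero'
      algebraicIndependent_cexp_I_cexp_one
  · refine algebraicIndependent_of_halfShear ((starRingEnd ℂ).comp σ)
      (t := 2 * Real.pi * I) (n := -n) ?_ ?_ (Or.inl ?_) (neg_ne_zero.mpr hn0) two_pi_I_ne_zero'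
      algebraicIndependent_cexp_I_cexp_one
    · simp only [RingHom.comp_apply, hn, map_add, map_mul,
        map_intCast, map_ofNat, Complex.conj_ofReal, Complex.conj_I]
      push_cast
      ring
    · simp only [RingHom.comp_apply, hτσ, map_neg, conj_two_pi_I,
        neg_neg]
    · simp only [RingHom.comp_apply, expEnd_apply_exp_one σ hσ,
        ← Complex.exp_conj, map_one]

/-! ### 4. The same, in the summit's format, and at `log 2` -/

/-- **SC(2) at `(iπ, ℓ)`** for a real `ℓ` with `e^ℓ ∈ ℚ`, IF some endomorphism of `ℂ_exp` moves
`ℓ`. [this file] -/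
theorem two_le_trdeg_expField_piI_log_of_expEnd (σ : ℂ →+* ℂ)
    (hσ : ∀ z, σ (cexp z) = cexp (σ z)) {ℓ : ℝ} {q : ℚ} (hℓ : Real.exp ℓ = q)
    (hmove : σ ℓ ≠ ℓ) :
    (2 : Cardinal) ≤ Algebra.trdeg ℚ ↥(expField ![(Real.pi : ℂ) * I, (ℓ : ℂ)]) := by
  set z : Fin 2 → ℂ := ![(Real.pi : ℂ) * I, (ℓ : ℂ)] with hz
  refine le_trdeg_expField_of_algebraicIndependent_adjoin (n := 2) {I} (fun x hx => ?_)
    (algebraicIndependent_log_pi_of_expEnd σ hσ hℓ hmove) (Fin.forall_fin_two.mpr ⟨?_, ?_⟩)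
  · rw [Set.mem_singleton_iff] at hx
    subst hx
    exact Literature.Barriers.Schanuel.isAlgebraic_I.tower_top _
  · exact subset_adjoin ℚ _ (Or.inl (Or.inl ⟨1, by simp [hz]⟩))
  · have hπI : (Real.pi : ℂ) * I ∈
        adjoin ℚ ((Set.range z ∪ Set.range (cexp ∘ z)) ∪ {I}) :=
      subset_adjoin ℚ _ (Or.inl (Or.inl ⟨0, by simp [hz]⟩))
    have hI : I ∈ adjoin ℚ ((Set.range z ∪ Set.range (cexp ∘ z)) ∪ {I}) :=
      subset_adjoin ℚ _ (Or.inr rfl)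
    have hπ : (Real.pi : ℂ) = (Real.pi : ℂ) * I * (-I) := by
      rw [mul_neg, mul_assoc, I_mul_I]
      ring
    have h : (![(ℓ : ℂ), (Real.pi : ℂ)] : Fin 2 → ℂ) 1 = (Real.pi : ℂ) := rfl
    rw [h, hπ]
    exact mul_mem hπI (neg_mem hI)

/-- **SC(2) at `(1, ℓ)`** for a real `ℓ` with `e^ℓ ∈ ℚ`, IF some endomorphism of `ℂ_exp` moves `ℓ`.
[this file] -/
theorem two_le_trdeg_expField_one_log_of_expEnd (σ : ℂ →+* ℂ)
    (hσ : ∀ z, σ (cexp z) = cexp (σ z)) {ℓ : ℝ} {q : ℚ} (hℓ : Real.exp ℓ = q)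
    (hmove : σ ℓ ≠ ℓ) :
    (2 : Cardinal) ≤ Algebra.trdeg ℚ ↥(expField ![(1 : ℂ), (ℓ : ℂ)]) :=
  le_trdeg_expField_of_algebraicIndependent (n := 2)
    (algebraicIndependent_log_exp_one_of_expEnd σ hσ hℓ hmove)
    (Fin.forall_fin_two.mpr
      ⟨by simpa using self_mem_expField ![(1 : ℂ), (ℓ : ℂ)] 1,
        by simpa using exp_mem_expField ![(1 : ℂ), (ℓ : ℂ)] 0⟩)

/-- `e^{log 2} = 2`. [folklore] -/
private theorem exp_log_two : Real.exp (Real.log 2) = ((2 : ℚ) : ℝ) := by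
  rw [Real.exp_log (by norm_num : (0 : ℝ) < 2)]
  norm_num

/-- **Theorem O at the emblematic pairs `(iπ, log 2)` and `(1, log 2)`.** The existence of ONE
endomorphism of `ℂ_exp` moving `log 2` implies Schanuel's conjecture at both pairs: `log 2 ⟂ π`,
`log 2 ⟂ e`, and the two transcendence-degree inequalities of the summit's format. (Complex
conjugation fixes `log 2`; no element of `End(ℂ_exp)` other than `1, c` is known [KMO2012;
AK2025, §6.4].) [this file] -/
theorem schanuel_pairs_log_two_of_expEnd_moves
    (h : ∃ σ : ℂ →+* ℂ, (∀ z, σ (cexp z) = cexp (σ z)) ∧ σ (Real.log 2 : ℝ) ≠ (Real.log 2 : ℝ)) :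
    AlgebraicIndependent ℚ ![((Real.log 2 : ℝ) : ℂ), (Real.pi : ℂ)] ∧
      AlgebraicIndependent ℚ ![((Real.log 2 : ℝ) : ℂ), cexp 1] ∧
      (2 : Cardinal) ≤ Algebra.trdeg ℚ ↥(expField ![(Real.pi : ℂ) * I, ((Real.log 2 : ℝ) : ℂ)]) ∧
      (2 : Cardinal) ≤ Algebra.trdeg ℚ ↥(expField ![(1 : ℂ), ((Real.log 2 : ℝ) : ℂ)]) := by
  obtain ⟨σ, hσ, hmove⟩ := h
  exact ⟨algebraicIndependent_log_pi_of_expEnd σ hσ exp_log_two hmove,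
    algebraicIndependent_log_exp_one_of_expEnd σ hσ exp_log_two hmove,
    two_le_trdeg_expField_piI_log_of_expEnd σ hσ exp_log_two hmove,
    two_le_trdeg_expField_one_log_of_expEnd σ hσ exp_log_two hmove⟩

/-- **Theorem O (i), packaged.** Every endomorphism of `ℂ_exp` fixes `e` and `e^e` and maps
`π ↦ ±π`: at the emblematic pairs `(1, iπ)` and `(1, e)` the automorphism door is shut for the
whole monoid `End(ℂ_exp)`, not only for complex conjugation. [this file] -/
theorem expEnd_fixes_e_expe_pm_pi (σ : ℂ →+* ℂ) (hσ : ∀ z, σ (cexp z) = cexp (σ z)) :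
    σ (cexp 1) = cexp 1 ∧ σ (cexp (cexp 1)) = cexp (cexp 1) ∧
      (σ (Real.pi : ℂ) = Real.pi ∨ σ (Real.pi : ℂ) = -Real.pi) :=
  ⟨expEnd_apply_exp_one σ hσ, expEnd_apply_exp_exp_one σ hσ, expEnd_apply_pi σ hσ⟩

end Summit.Schanuel.Schanuel.Theorems
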